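import Literature.AnabelianGeometry.SemiGraphs.SectionDoubleSheetWalk
import Literature.AnabelianGeometry.SemiGraphs.SectionPullbackInvisible
import Literature.AnabelianGeometry.Anabelioids.ComponentsOrbits
import HarnessLib

/-!
# The port swap: separating cells of `𝔾_A` unfolded into a non-separating port of a covering object are
# edge section labels ([SemiAnbd] §2, Def. 2.2 (i) p. 23, proof of Cor. 2.7 (i) p. 30)

Mochizuki, *Semi-graphs of anabelioids*, Publ. RIMS **42** (2006) 221–322, §2: Def. 2.2 (i) p. 23, proof of
Cor. 2.7 (i) p. 30 (two sheets `ℋ″`, `g·ℋ″` of a Galois covering) [cite: MochizukiSemiAnbd2006, Cor. 2.7(i) p.30].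

abc-iut cell, layer L3, FACT-LIST row F-1487 (`covering_subgraphComponents_doubleCosets` AS TYPED), CLASS route
«regluing invisibility» of abc-iut-w4-d080 (`HOME/staging/w4/w4-d080-g7/F1487-MASSBALANCE-MEMO.md` §3/§5/§9, GAP
G-w4d080-g7-1), brick **(R5f) PORT SWAP** — the SEPARATING half of the CORE LEMMA, in the form its consumer
(mass balance, R6) produces: seat abc-iut-L3-d2 (gen 9).  PROOF-ONLY (no definitions, no instances).

SETTING.  `φ : 𝒢′ → 𝒢` carries the GLOBAL clause `(α, e_B)` w.r.t. `A ∈ B(𝒢)`; `g : Y → A` is an object over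
`A` all of whose endomorphisms over `A` are automorphisms (e.g. `Y` connected, `B(𝒢)` being Galois for
connected `𝒢` — `Anabelioids.isIso_of_isConnected_of_endo`); `bc = (b₀, c)` is a branch-cell of the incidence
semi-graph `𝔾_Y = Y.fibreData.total` which is NON-SEPARATING there (its edge-cell has its other branch-cell
`bc₁` abutting to a vertex-cell reachable from that of `bc` by incidences avoiding `bc`), and the PORT
`c ⊆ Y_{e(b₀)}` lies over the component `Q ⊆ A_{e(b₀)}` under `g`.  (When `(e(b₀), Q)` is a SEPARATING cell of
`𝔾_A`, such a `Y` is what an "essential" far side provides at a Galois level — the port argument of the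
memo §3; that group-theoretic production is the business of R6/R7.)

* `Anabelioids.fst_comp_componentSwap_of_over_ne` — in a connected anabelioid, the swap of the two sheets
  of `X ⊔ X` over ONE component `c ⊆ X` (abc-iut-w4-d080 `componentSwap`) is the identity on the piece of
  `X ⊔ X` lying, under `X ⊔ X → X → Z`, over any component `P ⊆ Z` other than the one containing the
  image of `c` (fibre functor: components have disjoint fibre images);
* `Anabelioids.isIso_of_isConnected_of_endo` — an endomorphism of a connected object of a Galois category
  is an isomorphism (its fibre map is a surjective self-map of a finite set);
* `BObj.Hom.reglue_comp` — descending `g ≫ g′` to a reglued object is descending `g`, then `g′`;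
* ★ `Hom.exists_sectionE_label_of_port` — **the port swap**: under the setting above, `(b₀, Q)` IS an edge
  section label: some branch `b′` of `𝒢′` over `b₀` has the constituent `s_{e(b′)}` of the tautological
  section factoring through `φ^*(Q)`.  Proof: otherwise the section avoids `Q` over `b₀`, so the cross-reglue
  `(Y ⊔ Y)^{θ_c}` of the double of `Y` along the sheet swap over the port `c` is INVISIBLE over `A` (the
  engine `Hom.overIsoOfSupportedReglue`, abc-iut-w4-d080 p500354: the swap is supported over `Q`, away from
  the section); the first sheet `Y → Y ⊔ Y ≅ (Y ⊔ Y)^{θ_c}` followed by the descended codiagonal is an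
  endomorphism of `Y` over `A`, hence invertible, and correcting by its inverse yields a SECTION of
  `(Y ⊔ Y)^{θ_c} → Y` — impossible across the non-separating port (`BObj.not_exists_section_double_reglue_
  of_reachable`, brick R5e, applied to `Y`).

With R5e (`Hom.exists_sectionE_label_of_reachable`) this completes the detection side of the class route:
non-separating cells directly, separating cells through a port.  Remaining: R6 (mass balance + the
production of ports for essential separating cells) and R7 (hair).  No FACT-LIST label changes (F-1487 stays
open-as-typed, L3-lead δ22).  Nothing here takes a side on [IUTchIII] Cor. 3.12.
-/

namespace Literature.AnabelianGeometry

open CategoryTheory CategoryTheory.Limits CategoryTheory.PreGaloisCategory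

-- objects occur under several definitionally equal presentations; let unification see through them.
set_option backward.isDefEq.respectTransparency false

universe v₁ u₁ u

/-! ### Two facts about connected anabelioids -/

namespace Anabelioids

variable {C : Type u₁} [Category.{v₁} C] [GaloisCategory C]

/-- **An endomorphism of a connected object of a Galois category is an isomorphism**: its fibre map is a
surjective (the target is connected, the source has a point) self-map of a finite set, hence bijective, and
fibre functors reflect isomorphisms. [cite: MochizukiGeoAn2004, Prop. 1.1.4 p.11] -/
theorem isIso_of_isConnected_of_endo {X : C} [PreGaloisCategory.IsConnected X] (u : X ⟶ X) : IsIso u := by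
  let F := GaloisCategory.getFiberFunctor C
  haveI : Nonempty (F.obj X) := nonempty_fiber_of_isConnected F X
  have hs : Function.Surjective (F.map u) := surjective_of_nonempty_fiber_of_isConnected F u
  have hb : Function.Bijective (F.map u) := ⟨Finite.injective_iff_surjective.mpr hs, hs⟩
  haveI : IsIso (F.map u) := (ConcreteCategory.isIso_iff_bijective (F.map u)).mpr hb
  exact isIso_of_reflects_iso u F

/-- **The component swap is the identity over components away from the port.**  Let `f : X → Z`, let
`c ⊆ X` be a connected component mapping into the component `Q ⊆ Z`, and let `P ≠ Q` be another component of
`Z`.  Then on the piece of `X ⊔ X` over `P` (along `X ⊔ X → X → Z`) the swap of the two sheets over `c` is the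
identity: a point of that piece lies in a sheet over a component `P′` of `X` with `f(P′) ⊆ P`, so `P′ ≠ c`
(components of `Z` have disjoint fibre images), where the swap is trivial
(`fst_comp_componentSwap_of_ne`). [cite: MochizukiSemiAnbd2006, Cor. 2.7(i) p.30] -/
theorem fst_comp_componentSwap_of_over_ne {X Z : C} (f : X ⟶ Z) (c : SemiGraphs.π₀Obj X)
    (Q P : SemiGraphs.π₀Obj Z) (hcQ : ∃ k : (c.1 : C) ⟶ (Q.1 : C), k ≫ Q.1.arrow = c.1.arrow ≫ f)
    (hPQ : P ≠ Q) :
    pullback.fst (coprod.desc (𝟙 X) (𝟙 X) ≫ f) P.1.arrow ≫ (componentSwap X c).hom =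
      pullback.fst (coprod.desc (𝟙 X) (𝟙 X) ≫ f) P.1.arrow := by
  let F := GaloisCategory.getFiberFunctor C
  obtain ⟨k, hk⟩ := hcQ
  apply F.map_injective
  ext z
  rw [F.map_comp, FintypeCat.comp_apply]
  -- the point of `X ⊔ X` under `z`, its image in `X`, and the component `P′` of `X` containing it
  obtain ⟨P', p', hp'⟩ := exists_component_mem_range F
    (F.map (coprod.desc (𝟙 X) (𝟙 X)) (F.map (pullback.fst (coprod.desc (𝟙 X) (𝟙 X) ≫ f) P.1.arrow) z))
  -- the image in `Z` lies in `P` (pullback square)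
  have hzP : F.map f (F.map (coprod.desc (𝟙 X) (𝟙 X))
      (F.map (pullback.fst (coprod.desc (𝟙 X) (𝟙 X) ≫ f) P.1.arrow) z)) ∈ Set.range (F.map P.1.arrow) := by
    refine ⟨F.map (pullback.snd (coprod.desc (𝟙 X) (𝟙 X) ≫ f) P.1.arrow) z, ?_⟩
    have h1 : F.map (pullback.snd (coprod.desc (𝟙 X) (𝟙 X) ≫ f) P.1.arrow ≫ P.1.arrow) z =
        F.map (pullback.fst (coprod.desc (𝟙 X) (𝟙 X) ≫ f) P.1.arrow ≫ coprod.desc (𝟙 X) (𝟙 X) ≫ f) z := by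
      rw [pullback.condition]
    rw [F.map_comp, FintypeCat.comp_apply, F.map_comp, FintypeCat.comp_apply, F.map_comp,
      FintypeCat.comp_apply] at h1
    exact h1
  -- `P′ ≠ c`: otherwise that image would also lie in `Q`
  have hP'c : P' ≠ c := by
    intro hP'c
    subst hP'c
    apply hPQ
    refine component_eq_of_mem_range F P Q hzP ⟨F.map k p', ?_⟩
    have h2 : F.map (k ≫ Q.1.arrow) p' = F.map (P'.1.arrow ≫ f) p' := by rw [hk]
    rw [F.map_comp, FintypeCat.comp_apply, F.map_comp, FintypeCat.comp_apply, hp'] at h2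
    exact h2
  -- the point comes from the piece of `X ⊔ X` over `P′`, on which the swap is the identity
  have hr := fiberPullbackEquiv_symm_fst_apply (F := F) (f := coprod.desc (𝟙 X) (𝟙 X)) (g := P'.1.arrow)
    (F.map (pullback.fst (coprod.desc (𝟙 X) (𝟙 X) ≫ f) P.1.arrow) z) p' hp'.symm
  rw [← hr, ← FintypeCat.comp_apply (F.map _) (F.map (componentSwap X c).hom), ← F.map_comp,
    fst_comp_componentSwap_of_ne X c P' hP'c]

end Anabelioids

namespace SemiGraphs

namespace SemiGraphOfAnabelioids

variable {𝒢 𝒢' : SemiGraphOfAnabelioids.{v₁, u₁, u}}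

/-! ### Descending a composite to a reglued object -/

/-- Descending `g ≫ g′` to `B^θ` is descending `g` and composing with `g′` (same components).
[cite: MochizukiSemiAnbd2006, Def. 2.1 p.23] -/
theorem BObj.Hom.reglue_comp {B A A' : 𝒢.BObj} (g : B ⟶ A) (g' : A ⟶ A')
    (θ : ∀ b : 𝒢.graph.Branch, B.T (𝒢.graph.edgeOf b) ≅ B.T (𝒢.graph.edgeOf b))
    (hθ : ∀ b : 𝒢.graph.Branch, (θ b).hom ≫ g.fT (𝒢.graph.edgeOf b) = g.fT (𝒢.graph.edgeOf b))
    (hθ' : ∀ b : 𝒢.graph.Branch,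
      (θ b).hom ≫ (g ≫ g').fT (𝒢.graph.edgeOf b) = (g ≫ g').fT (𝒢.graph.edgeOf b)) :
    BObj.Hom.reglue (g ≫ g') θ hθ' = BObj.Hom.reglue g θ hθ ≫ g' := by
  apply BObj.hom_ext
  · funext v
    rfl
  · funext e
    rfl

/-! ### The port swap -/

namespace Hom

variable (φ : Hom 𝒢' 𝒢) {A : 𝒢.BObj} [HasBinaryProducts 𝒢.BObj] (α : Over A ⥤ 𝒢'.BObj) [α.IsEquivalence]
  (eB : φ.pullbackFunctor ≅ Over.star A ⋙ α)

/-- **The port swap** ([SemiAnbd] p. 30, two-sheet argument at a Galois level; abc-iut-w4-d080's CORE LEMMA,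
separating half, GAP G-w4d080-g7-1).  Let `φ : 𝒢′ → 𝒢` carry the GLOBAL clause `(α, e_B)` w.r.t. `A`; let
`g : Y → A` have all its endomorphisms over `A` invertible; let `bc = (b₀, c)` be a branch-cell of `𝔾_Y`,
NON-SEPARATING in `𝔾_Y` (`bc₁ ≠ bc` on the same edge-cell abutting to `vc₁`, reachable from the vertex-cell
`vc₀` of `bc` by incidences avoiding `bc`), whose port `c ⊆ Y_{e(b₀)}` lies over the component `Q ⊆ A_{e(b₀)}`.
Then `(b₀, Q)` is an EDGE SECTION LABEL: for some branch `b′` of `𝒢′` over `b₀` (abutting to a vertex) the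
constituent `s_{e(b′)}` of the tautological section `s = α(η_{𝟙_A}) ≫ e_B⁻¹_A` factors through
`φ_{e(b′)}^*(Q ↪ A_{e(b₀)})` (re-indexed to the edge of `φ b′`).  [Otherwise the cross-reglue of `Y ⊔ Y` along
the sheet swap over `c` is invisible over `A` (engine p500354), and the first sheet corrected by an
automorphism of `Y` is a section of `(Y ⊔ Y)^{θ_c} → Y`, which brick R5e forbids.]
[cite: MochizukiSemiAnbd2006, Cor. 2.7(i) p.30] -/
theorem exists_sectionE_label_of_port {Y : 𝒢.BObj} (g : Y ⟶ A)
    (hY : ∀ u : Y ⟶ Y, u ≫ g = g → IsIso u)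
    (bc : Y.fibreData.total.Branch) {vc₀ vc₁ : Y.fibreData.total.Vertex} {bc₁ : Y.fibreData.total.Branch}
    (h₀ : Y.fibreData.total.abuts bc = some vc₀) (h₁ : Y.fibreData.total.abuts bc₁ = some vc₁)
    (hne : bc₁ ≠ bc) (he : Y.fibreData.total.edgeOf bc₁ = Y.fibreData.total.edgeOf bc)
    (hreach : Relation.ReflTransGen
      (fun x y : Y.fibreData.total.Vertex => ∃ b b' : Y.fibreData.total.Branch,
        b ≠ bc ∧ b' ≠ bc ∧ Y.fibreData.total.edgeOf b = Y.fibreData.total.edgeOf b' ∧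
          Y.fibreData.total.abuts b = some x ∧ Y.fibreData.total.abuts b' = some y) vc₀ vc₁)
    (Q : π₀Obj (A.T (𝒢.graph.edgeOf (Y.fibreData.proj.branchMap bc))))
    (hcQ : ∃ k : ((Y.brComp bc).1 : 𝒢.E (𝒢.graph.edgeOf (Y.fibreData.proj.branchMap bc))) ⟶
        (Q.1 : 𝒢.E (𝒢.graph.edgeOf (Y.fibreData.proj.branchMap bc))),
      k ≫ Q.1.arrow = (Y.brComp bc).1.arrow ≫ g.fT (𝒢.graph.edgeOf (Y.fibreData.proj.branchMap bc))) :
    ∃ (b' : 𝒢'.graph.Branch) (v' : 𝒢'.graph.Vertex) (_ : 𝒢'.graph.abuts b' = some v')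
      (_ : φ.base.branchMap b' = Y.fibreData.proj.branchMap bc)
      (P : {P : Subobject (A.T (𝒢.graph.edgeOf (φ.base.branchMap b'))) //
        PreGaloisCategory.IsConnected (P : 𝒢.E (𝒢.graph.edgeOf (φ.base.branchMap b')))}),
      HEq P Q ∧
        ∃ t : (α.obj (Over.mk (𝟙 A))).T (𝒢'.graph.edgeOf b') ⟶
            (φ.φE (𝒢'.graph.edgeOf b') (𝒢.graph.edgeOf (φ.base.branchMap b'))
              (φ.base.edgeOf_branchMap b').symm).pullback.obj (P.1 : 𝒢.E _),
          t ≫ (φ.φE (𝒢'.graph.edgeOf b') (𝒢.graph.edgeOf (φ.base.branchMap b'))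
                (φ.base.edgeOf_branchMap b').symm).pullback.map P.1.arrow ≫
              (φ.reindexIso (𝒢'.graph.edgeOf b') _ _ (φ.base.edgeOf_branchMap b').symm rfl).hom.app A =
            (φ.globalSection α eB).fT (𝒢'.graph.edgeOf b') := by
  by_contra hcon
  -- the detection twist of the port: the sheet swap over `c` at `b₀`, identity elsewhere; it lies over `A`
  have hθ' : ∀ b : 𝒢.graph.Branch,
      (Y.doubleTwist (Y.fibreData.proj.branchMap bc) (Y.brComp bc) b).hom ≫
          (Y.codiag ≫ g).fT (𝒢.graph.edgeOf b) = (Y.codiag ≫ g).fT (𝒢.graph.edgeOf b) := by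
    intro b
    change (Y.doubleTwist (Y.fibreData.proj.branchMap bc) (Y.brComp bc) b).hom ≫
        (Y.codiag.fT (𝒢.graph.edgeOf b) ≫ g.fT (𝒢.graph.edgeOf b)) =
      Y.codiag.fT (𝒢.graph.edgeOf b) ≫ g.fT (𝒢.graph.edgeOf b)
    rw [← Category.assoc, Y.doubleTwist_codiag (Y.fibreData.proj.branchMap bc) (Y.brComp bc) b]
  -- the swap over the port is supported away from the section: the engine applies
  have hsupp : ∀ (b' : 𝒢'.graph.Branch) (v' : 𝒢'.graph.Vertex) (_ : 𝒢'.graph.abuts b' = some v'),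
      ∃ (C : 𝒢.E (𝒢.graph.edgeOf (φ.base.branchMap b')))
        (m : C ⟶ A.T (𝒢.graph.edgeOf (φ.base.branchMap b'))),
        pullback.fst ((Y.codiag ≫ g).fT (𝒢.graph.edgeOf (φ.base.branchMap b'))) m ≫
              (Y.doubleTwist (Y.fibreData.proj.branchMap bc) (Y.brComp bc) (φ.base.branchMap b')).hom =
            pullback.fst ((Y.codiag ≫ g).fT (𝒢.graph.edgeOf (φ.base.branchMap b'))) m ∧
          ∃ t : (α.obj (Over.mk (𝟙 A))).T (𝒢'.graph.edgeOf b') ⟶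
              (φ.φE (𝒢'.graph.edgeOf b') (𝒢.graph.edgeOf (φ.base.branchMap b'))
                (φ.base.edgeOf_branchMap b').symm).pullback.obj C,
            t ≫ (φ.φE (𝒢'.graph.edgeOf b') (𝒢.graph.edgeOf (φ.base.branchMap b'))
                  (φ.base.edgeOf_branchMap b').symm).pullback.map m ≫
                (φ.reindexIso (𝒢'.graph.edgeOf b') _ _ (φ.base.edgeOf_branchMap b').symm rfl).hom.app A =
              (φ.globalSection α eB).fT (𝒢'.graph.edgeOf b') := by
    intro b' v' h'
    -- the edge label `P` of `e(b′)` (abc-iut-f-161), re-indexed to the edge of `φ b′`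
    obtain ⟨P₀, hP₀, -⟩ := φ.existsUnique_component_sectionE_factors A α eB (𝒢'.graph.edgeOf b')
    obtain ⟨k₀, hk₀⟩ := φ.sectionE_factors_reindex A α eB (𝒢'.graph.edgeOf b')
      (𝒢.graph.edgeOf (φ.base.branchMap b')) (φ.base.edgeOf_branchMap b').symm P₀ hP₀
    have hlabel : ∃ (P : π₀Obj (A.T (𝒢.graph.edgeOf (φ.base.branchMap b'))))
        (k : (α.obj (Over.mk (𝟙 A))).T (𝒢'.graph.edgeOf b') ⟶
          (φ.φE (𝒢'.graph.edgeOf b') (𝒢.graph.edgeOf (φ.base.branchMap b'))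
            (φ.base.edgeOf_branchMap b').symm).pullback.obj (P.1 : 𝒢.E _)),
        k ≫ (φ.φE (𝒢'.graph.edgeOf b') (𝒢.graph.edgeOf (φ.base.branchMap b'))
              (φ.base.edgeOf_branchMap b').symm).pullback.map P.1.arrow =
          (φ.globalSection α eB).fT (𝒢'.graph.edgeOf b') ≫
            (φ.reindexIso (𝒢'.graph.edgeOf b') _ _ rfl (φ.base.edgeOf_branchMap b').symm).hom.app A :=
      ⟨_, k₀, hk₀⟩
    obtain ⟨P, k, hk⟩ := hlabel
    have hk' : k ≫ (φ.φE (𝒢'.graph.edgeOf b') (𝒢.graph.edgeOf (φ.base.branchMap b'))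
          (φ.base.edgeOf_branchMap b').symm).pullback.map P.1.arrow ≫
        (φ.reindexIso (𝒢'.graph.edgeOf b') _ _ (φ.base.edgeOf_branchMap b').symm rfl).hom.app A =
        (φ.globalSection α eB).fT (𝒢'.graph.edgeOf b') := by
      rw [← Category.assoc, hk, Category.assoc, Hom.reindexIso_hom_app_eq_inv_app, Iso.inv_hom_id_app]
      exact Category.comp_id _
    refine ⟨(P.1 : 𝒢.E _), P.1.arrow, ?_, k, hk'⟩
    by_cases hb : φ.base.branchMap b' = Y.fibreData.proj.branchMap bc
    · -- over `b₀`: the label `P` is not `Q` (else `(b₀, Q)` would be a label), so the swap fixes the piece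
      have hPQ : ¬ HEq P Q := fun hPQ => hcon ⟨b', v', h', hb, P, hPQ, k, hk'⟩
      clear hk' hk k
      revert P
      rw [hb]
      intro P hPQ
      have hPQ' : P ≠ Q := fun h => hPQ (heq_of_eq h)
      rw [Y.doubleTwist_self]
      exact Anabelioids.fst_comp_componentSwap_of_over_ne
        (g.fT (𝒢.graph.edgeOf (Y.fibreData.proj.branchMap bc))) (Y.brComp bc) Q P hcQ hPQ'
    · -- away from `b₀` the twist is the identity
      rw [Y.doubleTwist_of_ne (Y.fibreData.proj.branchMap bc) (Y.brComp bc) hb]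
      exact Category.comp_id _
  -- the engine: `(Y ⊔ Y → A) ≅ ((Y ⊔ Y)^θ → A)` over `A`
  let ι := φ.overIsoOfSupportedReglue α eB (Y.codiag ≫ g)
    (Y.doubleTwist (Y.fibreData.proj.branchMap bc) (Y.brComp bc)) hθ' hsupp
  have hw : ι.hom.left ≫ BObj.Hom.reglue (Y.codiag ≫ g)
      (Y.doubleTwist (Y.fibreData.proj.branchMap bc) (Y.brComp bc)) hθ' = Y.codiag ≫ g := Over.w ι.hom
  -- the first sheet, carried over, followed by the descended codiagonal: an endomorphism `u` of `Y` over `A`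
  have hu : ((Y.inl ≫ ι.hom.left) ≫ BObj.Hom.reglue Y.codiag
      (Y.doubleTwist (Y.fibreData.proj.branchMap bc) (Y.brComp bc))
      (Y.doubleTwist_codiag (Y.fibreData.proj.branchMap bc) (Y.brComp bc))) ≫ g = g := by
    rw [Category.assoc, Category.assoc, ← BObj.Hom.reglue_comp Y.codiag g _ _ hθ', hw, ← Category.assoc,
      Y.inl_codiag, Category.id_comp]
  haveI := hY _ hu
  -- correcting by `u⁻¹` gives a section of `(Y ⊔ Y)^θ → Y`: impossible across the non-separating port
  refine Y.not_exists_section_double_reglue_of_reachable bc h₀ h₁ hne he hreach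
    ⟨inv ((Y.inl ≫ ι.hom.left) ≫ BObj.Hom.reglue Y.codiag
        (Y.doubleTwist (Y.fibreData.proj.branchMap bc) (Y.brComp bc))
        (Y.doubleTwist_codiag (Y.fibreData.proj.branchMap bc) (Y.brComp bc))) ≫ (Y.inl ≫ ι.hom.left), ?_⟩
  rw [Category.assoc]
  exact IsIso.inv_hom_id _

end Hom

end SemiGraphOfAnabelioids

end SemiGraphs

end Literature.AnabelianGeometry
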